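import Summits.SmoothPoincare4.SmoothPoincare4.Theorems.EntropyRungCompactShrinkerGapJensenVolumeBound
import Literature.Geometry.Riemannian.BakryEmeryHeatFlow
import HarnessLib

/-!
# Weighted Dirichlet energy = weighted variance on a closed normalised 4-d gradient shrinker
(stub `stub_weightedDirichlet` of line `cgy-variance-pivot`, crux `EntropyRung.CompactShrinkerGap`,
item stmt-SmoothPoincare4-10870)

For a Riemannian metric `g` (Levi-Civita connection) on a closed `4`-manifold and a smooth `f`
with `Ric + Hess f = g/2` and `R + |∇f|² = f` (a normalised gradient shrinker, `τ = 1`):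

  `∫_M |∇f|² e^{-f} dV = ∫_M (f − 2)² e^{-f} dV`,

i.e. the weighted Dirichlet energy of the potential equals its weighted variance (the weighted
mean of `f` is `2`: `∫ f e^{-f} dV = 2 ∫ e^{-f} dV`, `integral_mul_exp_neg_eq_two_mul`).

Proof (three integral identities, all integrands continuous on a compact manifold of finite
volume):
* `Δ(e^{-f}) = (f − n/2) e^{-f}` with `n = finrank ℝ ℝ⁴ = 4`
  (`IsNormalisedShrinker.dalembertian_exp_neg`, Carrillo–Ni 2009, §2 and §4);
* Green's first identity on the closed manifold (`integral_mul_dalembertian_riemVolume`,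
  Lee 2018, Problem 2-23 (a)) with `u = f`, `v = e^{-f}`, and the chain rule
  `d(e^{-f}) = −e^{-f} df` (`mvfderiv_exp_neg_toLinearMap`):
  `∫ f (f − 2) e^{-f} dV = ∫ f Δ(e^{-f}) dV = −∫ g⁻¹(df, d(e^{-f})) dV = ∫ |∇f|² e^{-f} dV`;
* `(f − 2)² = f(f − 2) − 2f + 4` and `∫ f e^{-f} = 2 ∫ e^{-f}` give
  `∫ (f − 2)² e^{-f} = ∫ f(f − 2) e^{-f}`.

Sanity check: the round `S⁴(√6)` with `f ≡ 2` has both sides `0`.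
Everything is proved; no definition, no named fact.

References: J. A. Carrillo, L. Ni, Comm. Anal. Geom. 17 (2009), §2 (2.1)–(2.3) and §4
[CarrilloNi2009]; H.-D. Cao, M. Zhu, arXiv:1008.0842, (3.6)–(3.7) [CaoZhu2010];
J. M. Lee, *Introduction to Riemannian Manifolds* (2018), Problem 2-23 [Lee2018].
-/

noncomputable section

-- the registered namespace `Summit.SmoothPoincare4.SmoothPoincare4.Theorems` repeats a component
set_option linter.dupNamespace false

open Bundle Set Function Filter Module MeasureTheory
open scoped Manifold ContDiff Topology

namespace Summit.SmoothPoincare4.SmoothPoincare4.Theorems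

open Literature.Geometry Literature.Geometry.Lorentzian Literature.Geometry.Riemannian
  Literature.Geometry.Lorentzian.PseudoRiemannianMetric

/-- **STUB `stub_weightedDirichlet` of line `cgy-variance-pivot` — the weighted Dirichlet energy
of the potential of a closed normalised shrinker equals its weighted variance.** For `g`
Riemannian (Levi-Civita) on a closed 4-manifold and `f` smooth with `Ric + Hess f = g/2`,
`R + |∇f|² = f`: `∫ |∇f|² e^{-f} dV = ∫ (f − 2)² e^{-f} dV`. Proof: Green's first identity
`∫ f Δ(e^{-f}) dV = −∫ g⁻¹(df, d(e^{-f})) dV` (`integral_mul_dalembertian_riemVolume`) with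
`Δ(e^{-f}) = (f − 2) e^{-f}` (`IsNormalisedShrinker.dalembertian_exp_neg`, `finrank ℝ ℝ⁴ = 4`) and
`d(e^{-f}) = −e^{-f} df` (chain rule) gives `∫ f(f − 2) e^{-f} = ∫ |∇f|² e^{-f}`; then
`(f − 2)² = f(f − 2) − 2f + 4` and `∫ f e^{-f} = 2∫ e^{-f}` (`integral_mul_exp_neg_eq_two_mul`).
Both sides are the weighted variance `Var_{e^{-f}dV}(f)` (weighted mean of `f` is `2`). Check:
round `S⁴(√6)`, `f ≡ 2`: `0 = 0`.
[cite: CarrilloNi2009, §2 (2.1)–(2.3) and §4] [cite: Lee2018, Problem 2-23 (a)] -/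
theorem stub_weightedDirichlet :
    ∀ (M : Type) [TopologicalSpace M] [T2Space M] [SecondCountableTopology M]
      [ChartedSpace (EuclideanSpace ℝ (Fin 4)) M] [IsManifold (𝓡 4) ∞ M] [CompactSpace M]
      [T3Space M] [MeasurableSpace M] [BorelSpace M]
      (g : Literature.Geometry.Lorentzian.PseudoRiemannianMetric (𝓡 4) ∞ (EuclideanSpace ℝ (Fin 4))
        (TangentSpace (𝓡 4) : M → Type _)) [g.HasLeviCivita] (f : M → ℝ) (hg : g.IsRiemannian),
      ContMDiff (𝓡 4) 𝓘(ℝ, ℝ) ∞ f →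
      (∀ (x : M) (X Y : TangentSpace (𝓡 4) x),
        g.ricci x X Y + g.hessian f x X Y = (1 / 2 : ℝ) * g.val x X Y) →
      (∀ x : M, g.scalarCurvature x + g.gradSq f x = f x) →
      ∫ x, g.gradSq f x * Real.exp (-f x)
          ∂(Literature.Geometry.Lorentzian.riemannianMeasure (g.toContMDiffRiemannianMetric hg)) =
        ∫ x, (f x - 2) ^ 2 * Real.exp (-f x)
          ∂(Literature.Geometry.Lorentzian.riemannianMeasure (g.toContMDiffRiemannianMetric hg)) := by
  intro M _ _ _ _ _ _ _ _ _ g _ f hg hf hsol hnorm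
  -- the weighted mean of `f` is `2`: `∫ f e^{-f} dV = 2 ∫ e^{-f} dV`
  have hid := integral_mul_exp_neg_eq_two_mul M g f hg hf hsol hnorm
  -- the Riemannian measure is `g.riemVolume`
  have hV : g.riemVolume = riemannianMeasure (g.toContMDiffRiemannianMetric hg) :=
    PseudoRiemannianMetric.riemVolume_eq hg
  rw [← hV] at hid ⊢
  have hE : finrank ℝ (EuclideanSpace ℝ (Fin 4)) = 4 := finrank_euclideanSpace_fin
  -- the hypotheses say `(g, f, 1)` is a normalised gradient shrinker
  have h : g.IsNormalisedShrinker f 1 := (g.isNormalisedShrinker_one_iff f).2 ⟨hsol, hnorm⟩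
  -- regularity
  have hf1 : ContMDiff (𝓡 4) 𝓘(ℝ, ℝ) 1 f := hf.of_le (by norm_num)
  have he2 : ContMDiff (𝓡 4) 𝓘(ℝ, ℝ) 2 (fun y ↦ Real.exp (-f y)) :=
    ((Real.contDiff_exp.comp contDiff_neg).comp_contMDiff hf).of_le (WithTop.coe_le_coe.mpr le_top)
  have hEc : Continuous fun x ↦ Real.exp (-f x) := Real.continuous_exp.comp hf.continuous.neg
  -- integrability of the (continuous) integrands for the finite measure `dV_g`
  have hint : Integrable (fun x ↦ Real.exp (-f x)) g.riemVolume :=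
    integrable_exp_neg_of_contMDiff hf
  have hfint : Integrable (fun x ↦ f x * Real.exp (-f x)) g.riemVolume :=
    g.integrable_of_continuous (hf.continuous.mul hEc)
  have iA : Integrable (fun x ↦ f x * (f x - 2) * Real.exp (-f x)) g.riemVolume :=
    g.integrable_of_continuous
      ((hf.continuous.mul (hf.continuous.sub continuous_const)).mul hEc)
  have iB : Integrable (fun x ↦ 2 * (f x * Real.exp (-f x))) g.riemVolume := hfint.const_mul 2
  have iC : Integrable (fun x ↦ 4 * Real.exp (-f x)) g.riemVolume := hint.const_mul 4
  have iBC : Integrable (fun x ↦ 2 * (f x * Real.exp (-f x)) - 4 * Real.exp (-f x)) g.riemVolume :=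
    iB.sub iC
  -- pointwise: `f Δ(e^{-f}) = f (f − 2) e^{-f}`
  have hL : ∀ x, f x * g.dalembertian (fun y ↦ Real.exp (-f y)) x =
      f x * (f x - 2) * Real.exp (-f x) := by
    intro x
    rw [h.dalembertian_exp_neg hf x, hE]
    push_cast
    ring
  -- pointwise: `g⁻¹(df, d(e^{-f})) = −|∇f|² e^{-f}` (chain rule `d(e^{-f}) = −e^{-f} df`)
  have hR : ∀ x, g.innerDual x (mvfderiv (𝓡 4) f x : TangentSpace (𝓡 4) x →ₗ[ℝ] ℝ)
      (mvfderiv (𝓡 4) (fun y ↦ Real.exp (-f y)) x : TangentSpace (𝓡 4) x →ₗ[ℝ] ℝ) =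
      -(g.gradSq f x * Real.exp (-f x)) := by
    intro x
    have hgrad : g.innerDual x (mvfderiv (𝓡 4) f x : TangentSpace (𝓡 4) x →ₗ[ℝ] ℝ)
        (mvfderiv (𝓡 4) f x : TangentSpace (𝓡 4) x →ₗ[ℝ] ℝ) = g.gradSq f x := rfl
    rw [mvfderiv_exp_neg_toLinearMap (hf1.mdifferentiableAt one_ne_zero), g.innerDual_smul_right,
      hgrad]
    ring
  -- Green's first identity: `∫ f Δ(e^{-f}) dV = −∫ g⁻¹(df, d(e^{-f})) dV`
  have key : ∫ x, f x * (f x - 2) * Real.exp (-f x) ∂g.riemVolume =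
      ∫ x, g.gradSq f x * Real.exp (-f x) ∂g.riemVolume := by
    have hG := integral_mul_dalembertian_riemVolume g hg hf1 he2
    simp_rw [hL, hR, integral_neg, neg_neg] at hG
    exact hG
  -- `(f − 2)² e^{-f} = f(f − 2) e^{-f} − (2 f e^{-f} − 4 e^{-f})`, and `∫ f e^{-f} = 2 ∫ e^{-f}`
  have hsq : ∀ x, (f x - 2) ^ 2 * Real.exp (-f x) =
      f x * (f x - 2) * Real.exp (-f x) - (2 * (f x * Real.exp (-f x)) - 4 * Real.exp (-f x)) := by
    intro x
    ring
  have e3 : ∫ x, (f x - 2) ^ 2 * Real.exp (-f x) ∂g.riemVolume =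
      ∫ x, f x * (f x - 2) * Real.exp (-f x) ∂g.riemVolume -
        (2 * ∫ x, f x * Real.exp (-f x) ∂g.riemVolume - 4 * ∫ x, Real.exp (-f x) ∂g.riemVolume) := by
    simp_rw [hsq]
    rw [integral_sub iA iBC, integral_sub iB iC, integral_const_mul, integral_const_mul]
  rw [e3, hid, key]
  ring

end Summit.SmoothPoincare4.SmoothPoincare4.Theorems

end
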